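import Mathlib
import HarnessLib

/-!
# Magnen–Rivasseau–Sénéor, *Construction of YM₄ with an infrared cutoff* (CMP 155, 1993), §III LEMMA III.1 —
# the PRINTED one-loop arithmetic of the gauge-restoring counterterms, kernel-checked: the `d = 4`
# «Euclidean symmetry» conversion rates, the four `A⁴` graphs and «the 4 coefficients add up to 0», the three
# `A²` graphs and «−2 … independent of ζ», the cutoff plateau of (II.14) and the `|ln η|` coefficient (III.6),
# the sign analysis «greater than 17/20», «(17/20) · (9/8) ≥ 1/2» and the stabilizing bound (III.7)

statement-level skeleton of published theorems with citation tags; proofs where landed; nothing here is a claim about the Yang–Mills mass gap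

**Citation header (reproduction of PUBLISHED work).** J. Magnen, V. Rivasseau, R. Sénéor, *Construction of YM₄ with
an infrared cutoff*, Commun. Math. Phys. **155** (1993) 325–383 [MagnenRivasseauSeneor1993], Sect. III «Computation of
the Counterterms due to the Ultraviolet Cutoff», pp. 347–352, and the cutoff (II.13)–(II.14) p. 331. Loci `p.NNN tl.nn`
are journal page and text-layer line of the held Project Euclid scan `paper:magnen1993-cmp155-mrs-ym4-infrared-cutoff`
(PDF page = journal page − 324). This file is the Lean lane of the lit-balaban YM LIT SWEEP row D1 (register level; it
bears on no verdict of that table): it certifies the finite arithmetic the paper prints, nothing of its functional analysis.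

**What the paper prints (verbatim, OA text layer).**
* p.348 tl.24–28: *«At one loop, which also means at order λ⁴ in perturbation theory, there are 4 graphs which may
  contribute to the A⁴ term … called G₁, G₂, G₃ and G₄.»*  p.349 tl.8–10 (G₁): *«Collecting all factors we obtain a
  positive coefficient 3·4(3 + 3(1/ζ − 1)/2 + 5(1/ζ − 1)²/8) = 36 + 18(1/ζ − 1) + 15(1/ζ − 1)²/2 in front of the
  integration ∫d⁴k/k⁴ over the loop momentum of G₁.»*  p.349 tl.29–30 (G₂): *«which is equivalent by Euclidean symmetry to
  −90 − 45(1/ζ − 1) − 15(1/ζ − 1)²»*.  p.350 tl.2–4 (G₃): *«taking into account Euclidean symmetry to convert it into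
  units of ∫d⁴k/k⁴, we find a final factor … of 6(9 + 1/4 + 9(1/ζ − 1)/2 + 5(1/ζ − 1)²/4) = 55.5 + 27(1/ζ − 1) +
  7.5(1/ζ − 1)².»*  p.350 tl.10–12 (G₄, ghost loop): *«Hence the contribution is −12k₁⁴ in front of the integration over
  the loop momentum of G₄. Applying the same conversion rate, we obtain in units of (k²)² a final combinatoric factor of
  −1.5.»*  p.350 tl.13–15: *«Remark that when the cutoff is 1 we can all add the terms together and the 4 coefficients add
  up to 0. This is a particular case of the famous miracle of renormalizability (at one loop...) of four dimensional
  gauge theories.»*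
* p.350 tl.21–34 (the A² graphs G′₁, G′₂, G′₃): *«Hence the contribution is −6(1 + (1/ζ − 1)/4) …»*, *«= (9/2 +
  6(1/ζ − 1)/4) in front of the integration over the loop momentum»*, *«The contributions is therefore −2k₁²/k⁴ =
  −(1/2)/k² …»*, *«The result for the (A²/2) term in the region where the ultraviolet cutoff is one is obtained by adding
  all the terms and is −6 − 6/4(1/ζ − 1) − 1/2 + 9/2 + 6/4(1/ζ − 1) = −2 times the loop integration. Remark that this
  result is independent of ζ.»*
* (II.14) p.331 tl.3–7: *«κ(p) = 1 if |p| ≤ 1, … , κ(p) = 1/2 if 2 ≤ |p| ≤ 2 + η⁻¹, κ(p) = (1/2)τ(|p| − 1 − η⁻¹) if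
  [|p| ≥ 2 + η⁻¹], where η is a small constant. This unusual form … leads to a stabilizing A⁴ counterterm whose strength
  can be made as large as desired»*.  (III.4) p.351 tl.16–20: the one-loop contribution to the (A⁴/24) term for a single
  cutoff κ_ρ(p) = κ(pM^{−ρ}) is *«∫(d⁴p/p⁴)[(36 + 18(1/ζ − 1) + 7.5(1/ζ − 1)²)κ²(pM^{−ρ}) − (90 + 45(1/ζ − 1) +
  15(1/ζ − 1)²)κ³(pM^{−ρ}) + (54 + 27(1/ζ − 1) + 7.5(1/ζ − 1)²)κ⁴(pM^{−ρ})] = 0·[…] + finite terms»*.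
* (III.6) p.352 tl.2–6: *«As a consequence the one loop (A⁴/24) contribution behaves as [ (36 + 18(1/ζ − 1) + 7.5(1/ζ −
  1)²)/4 − (90 + 45(1/ζ − 1) + 15(1/ζ − 1)²)/8 + (54 + 27(1/ζ − 1) + 7.5(1/ζ − 1)²)/16 ](−ln η) + finite terms =
  9/8(1 + (1/ζ − 1/2 + 5/12(1/ζ − 1)²)|ln η| + finite terms, where "finite terms" now means terms which are uniformly
  bounded both as ρ tends to +∞ and η tends to 0.»* (The right-hand side is printed with a dropped parenthesis, «(1/ζ −
  1/2» for «(1/ζ − 1)/2»; the three brackets fix the reading `9/8(1 + (1/ζ − 1)/2 + 5/12(1/ζ − 1)²)`,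
  `lnEtaCoeff_eq_printed_bracket`. In the scan's text layer the first display line is legible only in its three brackets
  and the denominators «8», «16»; the «/4» under the κ² bracket is the plateau weight 2⁻² PROVED below from (II.14) and is
  confirmed by the printed right-hand side; the displays of p.352 were re-read on a page render (v1.2).)
* p.352 tl.8–13: *«The polynomial 1 + (1/ζ − 1)2 + (5/12)(1/ζ − 1)² [sic: «)2» for «)/2»] is always positive and
  greater than 17/20. Since (17/20) · (9/8) ≥ 1/2, taking η small enough (depending on the details of our cutoff, which
  are responsible for the particular value of the finite terms) we can always achieve our goal of a positive total A⁴
  contribution, hence of a negative stabilizing counterterm, with value at least e^{−(1/2) ∫_Λ (A⁴/24) |ln η|}.»* (III.7)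
  (the display (III.7) is the exponential; v1.0–v1.1 of this docstring quoted the text layer's «(17/20)(9/8) > 1/2» and
  dropped the `e^{…}` and the `Λ` of (III.7) — corrected here from the page render, no declaration affected); tl.14–15
  *«Remark that the coefficient of this stabilizing term can be made as large as we want, if η is small enough.»*

**What is reproduced here (kernel-checked, zero `sorry`, zero named facts).**
* §1 THE `d = 4` CONVERSION RATES («Euclidean symmetry», «in units of (k²)²») in Gaussian-moment form on
  `ℝ⁴ = Fin 4 → ℝ` with the weight `e^{−|k|²}`: `convRate_sq` `∫k_μ² = ¼∫|k|²`, **`convRate_fourth`** `∫k_μ⁴ = ⅛∫|k|⁴`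
  (the printed «conversion rate» `−12k₁⁴ ↦ −1.5`, `G4_eq`), `convRate_sq_sq` `∫k_μ²k_ν² = (1/24)∫|k|⁴` (`μ ≠ ν`); from the
  one-dimensional moments `M₀ = √π`, `M₂ = √π/2`, `M₄ = 3√π/4` (file-private plumbing `gaussMoment_zero/two/four`, via
  Mathlib's `integral_rpow_mul_exp_neg_rpow` and `Real.Gamma_nat_add_half`) and Fubini (`integral_monomial_mul_gauss4`).
* §2 the four A⁴ coefficients AS PRINTED as polynomials in `t = 1/ζ − 1` (`G1`…`G4`, with `G1_eq`, `G3_eq`, `G4_eq` the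
  printed evaluations `36 + 18t + 15t²/2`, `55.5 + 27t + 7.5t²`, `−1.5`); §3 **`one_loop_A4_sum_eq_zero`**:
  `G₁ + G₂ + G₃ + G₄ = 0` for EVERY gauge parameter (the printed «4 coefficients add up to 0», order by order
  `one_loop_A4_sum_by_order`); §4 the A² graphs `G1'`, `G2'`, `G3'` and **`one_loop_A2_sum`** `= −2`, ζ-independent.
* §5 THE PLATEAU MECHANISM: on the plateau of (II.14) a graph with `n` propagators carries `κⁿ = 2⁻ⁿ` (`plateauWeight`);
  `plateau_radial_integral` `∫_2^{2+η⁻¹} 2⁻ⁿ dr/r = 2⁻ⁿ log((2 + η⁻¹)/2)`, `log_plateau_eq` `= 2⁻ⁿ(−log η) + 2⁻ⁿ log((1 +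
  2η)/2)` with `|log((1 + 2η)/2)| ≤ log 2` for `0 < η ≤ ½` (`plateau_radial_integral_sub_le`: the «finite terms» of the
  plateau are explicit); in `d = 4` proper, **`integral_shell_eq`**: `∫_{ℝ⁴} 𝟙_{2 ≤ |p| ≤ 2+η⁻¹} κ(p)ⁿ/|p|⁴ d⁴p =
  2π²·2⁻ⁿ·log((2 + η⁻¹)/2)` (polar coordinates `integral_fun_norm_addHaar`, `|S³| = 4·vol(B⁴) = 2π²`,
  `volume_real_ball_four`); hence the `|ln η|`-coefficient `lnEtaCoeff t = G₁/4 + G₂/8 + (G₃ + G₄)/16` and **(III.6)**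
  `lnEtaCoeff_eq`: `= 9/8(1 + t/2 + 5t²/12)`, `lnEtaCoeff_eq_printed_bracket` (the printed three-bracket line), and the
  assembled shell form `one_loop_A4_shell_eq` `G₁∫κ² + G₂∫κ³ + (G₃ + G₄)∫κ⁴ = 2π²·9/8(1 + t/2 + 5t²/12)·log((2 + η⁻¹)/2)`.
* §6 THE SIGN ANALYSIS: `signPoly_ge` `1 + t/2 + 5t²/12 ≥ 17/20` for all real `t`, **`signPoly_eq_iff`** (precision,
  ours: `17/20` is attained, exactly at `t = −3/5`, i.e. `ζ = 5/2` — the print's «greater than» is `≥`, strict for every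
  other `ζ`, `signPoly_gt_of_ne`), `signPoly_pos`, `key_product_gt_half` `(17/20)(9/8) = 153/160 > 1/2` (the print's
  «≥ 1/2», strictly), `lnEtaCoeff_ge`
  `≥ 153/160`; and **(III.7)** made quantitative: `stabilizing_coefficient_ge_half(_log)` — if the finite terms are
  bounded by `C` then for `0 < η ≤ exp(−160C/73)` the total one-loop (A⁴/24) coefficient `c(ζ)|ln η| + F ≥ ½|ln η|` in
  every gauge — and `stabilizing_coefficient_large` («as large as we want, if η is small enough»).

**v1.1 (same seat, append-only).** §7 THE HOMOTHETIC GAUGE VALUE `ζ = 3/13` (p.332 tl.37 – p.333 tl.4): *«[the gauge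
parameter] ζ … takes a value close to 3/13. This value is chosen so that there is no infinite wave function renormalization;
indeed the one loop wave function renormalization is proportional to 10/3 + (1 − 1/ζ), hence vanishes for ζ = 3/13 [IZ].»* —
`waveFunctionCoeff ζ = 10/3 + (1 − 1/ζ)`, **`waveFunctionCoeff_eq_zero_iff`** (`= 0 ↔ ζ = 3/13`), the `t = 1/ζ − 1` form
`10/3 − t`, and the sign on either side of `3/13` (`waveFunctionCoeff_pos_iff`): the printed root, kernel-checked; the
proportionality itself (a one-loop computation of [IZ]) is a typed input. §8 SECT. VI AT FIRST ORDER IN `β` —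
(VI.17)–(VI.19) pp.373–374: the hyperspherical angular integrals of the measure «`sin²θ sinφ dθ dφ`» (p.372 tl.9–10),
`∫₀^π sin²θ = π/2`, `∫₀^π sinφ = 2`, `∫₀^π sin²θcos²θ = π/8`, `∫₀^π sin⁴θ = 3π/8`, `∫₀^π cos²φ sinφ = 2/3` (Mathlib), hence
**`angularAverage_FP`** `⟨cos²θ + t² sin²θ cos²φ⟩ = (1 + t²)/4` (the Faddeev–Popov first-order term); the printed
first-order brackets `bosonFirstOrder` ((VI.17): `G′₁`, `G′₂` of Sect. III plus the «new vertex» graphs `−2ζ(1 + (1/ζ−1)/4)`,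
`κ(−2 + (3/2)ζ)`), `countertermFirstOrder` ((VI.16)/(VI.18), `countertermFirstOrder_eq`: = `−G′₁ − κG′₂ − κG′₃`),
`fpFirstOrder = −κ/2`, and **`firstOrder_assembly`**: their sum is the printed (VI.18) bracket `−3ζ/2 − 1/2 − κ(2 − (3/2)ζ)`
identically in `ζ ≠ 0`, `κ`; **`ineq_VI19`** / `firstOrder_lt`: `(β/2)(1+t²)[…] < −(β/4)(1+t²) ≤ −β/4` for `0 < ζ < 1`,
`κ ≥ 0`, `β > 0` — a true STRICT VARIANT of (VI.19), which PRINTS (p.374 tl.1–2, page image) «If we restrict us to the region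
`0 ≤ ζ ≤ 1`, we have `(β/2)(1+t²)[−3ζ/2 − 1/2 − κ(2 − (3/2)ζ)] ≤ −(β/4)(1+κ) ≤ −(β/4)`. (VI.19)»; the printed chain itself is
the tree's `MagnenRivasseauSeneor1993.Stability.ineq_VI19_asPrinted` (`MRS93StabilityEstimate.lean`) (v1.3). The `O(β²)` remainder, Lemma VI.2 and (VI.35) are NOT claimed (their displays are not legible
in the held text layer; they involve the unevaluated polynomial `P` of the 12 × 12 determinant (VI.9)).

**Readings (declared).** (i) The pre-conversion numbers of each graph (the Wick-contraction counts `3·4(…)`, `6(…)`,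
`−12k₁⁴`, `−6(1 + t/4)`, `2(…)`, `−2k₁²/k⁴`) are TYPED INPUTS: the Feynman rules of Fig. III.1 and the tensor
contractions of pp. 348–350 are not formalised; what is checked is every arithmetic step the paper prints from them,
the `d = 4` angular conversions it invokes, and the plateau integral behind (III.6). (ii) The conversion rates are proved
as ratios of isotropic Gaussian moments on `ℝ⁴` (the weight `e^{−|k|²}` factorises radially, so these are the ratios
«in units of (k²)²» of the print). (iii) The «finite terms» of (III.6)–(III.7) enter §6 as a hypothesis `|F| ≤ C`, exactly
the paper's *«uniformly bounded both as ρ tends to +∞ and η tends to 0»*; for the plateau itself the bound is proved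
(`≤ 2⁻ⁿ log 2`). (iv) `|ln η| = −log η` for `0 < η < 1`.

**What is NOT claimed.** Lemma III.1's values (III.2) of `a_ρ, …, e_ρ` (the display is not legible in the held text
layer and is not typed); the interpolating shape `τ` of (II.14) and the regions `|p| ≤ 2`, `|p| ≥ 2 + η⁻¹` (they produce
the «finite terms»); anything of Sects. IV–VIII (large/small field expansion, Lemma VI.1, Slavnov identities); any
statement about a β-function, a coupling flow or ultraviolet stability of YM₄. Nothing here bears on Bałaban's papers or
on the Clay problem.

**v1.2 (p12 gen 17): DOCSTRING-ONLY fidelity fix — every declaration byte-identical to v1.1.** The p.352 quotations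
(title line, (III.6) right-hand side, tl.8–13 with (III.7), the docstrings of `key_product_gt_half` and
`stabilizing_coefficient_ge_half`) re-read on a page render of CMP 155 p.352: the page prints «(17/20) · (9/8) ≥ 1/2»
(text layer: «> 1/2»), «1 + (1/ζ − 1)2 + (5/12)(1/ζ − 1)²» and «(1/ζ − 1/2 + 5/12(1/ζ − 1)²)» (two dropped symbols, read
through the three printed brackets), and (III.7) is the exponential `e^{−(1/2)∫_Λ(A⁴/24)|ln η|}`. Pointed out (for «≥») by
the lit-balaban fit-ref B seat (p18 gen 41, ROWS.md v72 AI, 2026-08-22).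

**v1.3 (p12 gen 18): DOCSTRING-ONLY fidelity fix — every declaration byte-identical to v1.2.** (VI.19) p.374 re-read on
the page image `inprint/lit-balaban-p14/renders-cmp155/p50_top_s2.png`: the print has «0 ≤ ζ ≤ 1» and
«≤ −(β/4)(1 + κ) ≤ −(β/4)»; v1.1–v1.2 quoted the text layer («0 < ζ < 1», «< −(β/4)(1 + t²)»). `OneLoop.ineq_VI19` is
unchanged and now described as a strict VARIANT; the printed chain is `Stability.ineq_VI19_asPrinted` of
`MRS93StabilityEstimate.lean`. Pointed out by the pub-balaban-gaps seat mrs-lit-2 (HOME/INBOX 2026-08-22T20:04:51Z).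
-/

noncomputable section

open Real MeasureTheory MeasureTheory.Measure Set Finset Metric intervalIntegral

namespace Literature.MathematicalPhysics.QuantumFieldTheory.MagnenRivasseauSeneor1993

namespace OneLoop

/-! ## §1 The `d = 4` «Euclidean symmetry» conversion rates -/

/-- The one-dimensional Gaussian moment `M_n = ∫_ℝ xⁿ e^{−x²} dx`. [folklore] -/
def gaussMoment (n : ℕ) : ℝ := ∫ x : ℝ, x ^ n * exp (-x ^ 2)

/-- `xⁿ e^{−x²}` is integrable on `ℝ`. [folklore] -/
private theorem integrable_pow_mul_exp_neg_sq (n : ℕ) :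
    Integrable (fun x : ℝ => x ^ n * exp (-x ^ 2)) := by
  have hn : (-1 : ℝ) < (n : ℝ) := by
    have := Nat.cast_nonneg (α := ℝ) n
    linarith
  have h := integrable_rpow_mul_exp_neg_mul_sq (b := 1) one_pos hn
  refine h.congr ?_
  filter_upwards with x
  simp [Real.rpow_natCast]

/-- Half-line Gaussian moments: `∫₀^∞ xⁿ e^{−x²} dx = ½ Γ((n+1)/2)`. [folklore] -/
private theorem integral_pow_mul_exp_neg_sq_Ioi (n : ℕ) :
    ∫ x in Ioi (0 : ℝ), x ^ n * exp (-x ^ 2) = (1 / 2) * Gamma (((n : ℝ) + 1) / 2) := by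
  have hn : (-1 : ℝ) < (n : ℝ) := by
    have := Nat.cast_nonneg (α := ℝ) n
    linarith
  have h := integral_rpow_mul_exp_neg_rpow (p := 2) (q := (n : ℝ)) two_pos hn
  rw [← h]
  refine setIntegral_congr_fun measurableSet_Ioi (fun x _ => ?_)
  simp [Real.rpow_natCast]

/-- Even Gaussian moments over the line: `M_{2m} = Γ(m + ½)`. [folklore] -/
private theorem gaussMoment_two_mul (m : ℕ) : gaussMoment (2 * m) = Gamma ((m : ℝ) + 1 / 2) := by
  unfold gaussMoment
  have h1 : (fun x : ℝ => x ^ (2 * m) * exp (-x ^ 2)) =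
      fun x => (fun y : ℝ => y ^ (2 * m) * exp (-y ^ 2)) |x| := by
    funext x
    simp [(even_two_mul m).pow_abs, sq_abs]
  rw [h1, integral_comp_abs (f := fun y : ℝ => y ^ (2 * m) * exp (-y ^ 2)), integral_pow_mul_exp_neg_sq_Ioi]
  push_cast
  ring_nf

/-- `M₀ = √π`. [folklore] -/
private theorem gaussMoment_zero : gaussMoment 0 = √π := by
  have h := gaussMoment_two_mul 0
  rw [Nat.mul_zero] at h
  rw [h]
  rw [Real.Gamma_nat_add_half 0]
  norm_num [Nat.doubleFactorial]

/-- `M₂ = √π/2`. [folklore] -/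
private theorem gaussMoment_two : gaussMoment 2 = √π / 2 := by
  have h := gaussMoment_two_mul 1
  rw [Nat.mul_one] at h
  rw [h]
  rw [Real.Gamma_nat_add_half 1]
  norm_num [Nat.doubleFactorial]

/-- `M₄ = 3√π/4`. [folklore] -/
private theorem gaussMoment_four : gaussMoment 4 = 3 * √π / 4 := by
  have h := gaussMoment_two_mul 2
  rw [show 2 * 2 = 4 from rfl] at h
  rw [h]
  rw [Real.Gamma_nat_add_half 2]
  norm_num [Nat.doubleFactorial]

/-- The isotropic Gaussian weight `e^{−|k|²}` on `ℝ⁴ = Fin 4 → ℝ`, in product form. [folklore] -/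
def gauss4 (k : Fin 4 → ℝ) : ℝ := ∏ i, exp (-(k i) ^ 2)

/-- `|k|² = Σ_μ k_μ²`. [folklore] -/
def normSq (k : Fin 4 → ℝ) : ℝ := ∑ i, (k i) ^ 2

/-- `∏_μ e^{−k_μ²} = e^{−|k|²}`. [folklore] -/
private theorem gauss4_eq (k : Fin 4 → ℝ) : gauss4 k = exp (-normSq k) := by
  simp [gauss4, normSq, ← Real.exp_sum]

/-- Fubini: `∫_{ℝ⁴} (∏_μ k_μ^{e_μ}) e^{−|k|²} d⁴k = ∏_μ M_{e_μ}`. [folklore] -/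
private theorem integral_monomial_mul_gauss4 (e : Fin 4 → ℕ) :
    ∫ k : Fin 4 → ℝ, (∏ i, (k i) ^ (e i)) * gauss4 k = ∏ i, gaussMoment (e i) := by
  have : (fun k : Fin 4 → ℝ => (∏ i, (k i) ^ (e i)) * gauss4 k) =
      fun k => ∏ i, ((k i) ^ (e i) * exp (-(k i) ^ 2)) := by
    funext k
    rw [gauss4, ← Finset.prod_mul_distrib]
  rw [this]
  exact MeasureTheory.integral_fintype_prod_volume_eq_prod (fun i (x : ℝ) => x ^ (e i) * exp (-x ^ 2))

/-- Integrability of the monomial Gaussian integrands on `ℝ⁴`. [folklore] -/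
private theorem integrable_monomial_mul_gauss4 (e : Fin 4 → ℕ) :
    Integrable (fun k : Fin 4 → ℝ => (∏ i, (k i) ^ (e i)) * gauss4 k) := by
  have : (fun k : Fin 4 → ℝ => (∏ i, (k i) ^ (e i)) * gauss4 k) =
      fun k => ∏ i, ((k i) ^ (e i) * exp (-(k i) ^ 2)) := by
    funext k
    rw [gauss4, ← Finset.prod_mul_distrib]
  rw [this]
  exact MeasureTheory.Integrable.fintype_prod (fun i => integrable_pow_mul_exp_neg_sq (e i))

/-- `k_a⁴ = ∏_μ k_μ^{4[μ = a]}` (plumbing). [folklore] -/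
private theorem pow_four_eq_prod (k : Fin 4 → ℝ) (a : Fin 4) :
    (k a) ^ 4 = ∏ i, (k i) ^ (if i = a then 4 else 0) := by
  rw [Finset.prod_eq_single a]
  · simp
  · intro b _ hb
    simp [hb]
  · simp

/-- `k_a² k_b² = ∏_μ k_μ^{2[μ = a] + 2[μ = b]}` for `a ≠ b` (plumbing). [folklore] -/
private theorem sq_mul_sq_eq_prod (k : Fin 4 → ℝ) {a b : Fin 4} (hab : a ≠ b) :
    (k a) ^ 2 * (k b) ^ 2 = ∏ i, (k i) ^ (if i = a then 2 else if i = b then 2 else 0) := by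
  rw [Finset.prod_eq_mul a b hab]
  · simp [hab.symm]
  · intro c _ hc
    simp [hc.1, hc.2]
  · simp
  · simp

/-- `∫ k_a⁴ e^{−|k|²} d⁴k = M₄M₀³`. [folklore] -/
private theorem integral_fourth_mul_gauss4 (a : Fin 4) :
    ∫ k : Fin 4 → ℝ, (k a) ^ 4 * gauss4 k = gaussMoment 4 * gaussMoment 0 ^ 3 := by
  have h := integral_monomial_mul_gauss4 (fun i => if i = a then 4 else 0)
  have h2 : (fun k : Fin 4 → ℝ => (k a) ^ 4 * gauss4 k) =
      fun k => (∏ i, (k i) ^ (if i = a then 4 else 0)) * gauss4 k := by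
    funext k
    rw [pow_four_eq_prod]
  rw [h2, h]
  fin_cases a <;> simp [Fin.prod_univ_four] <;> ring

/-- `∫ k_a² k_b² e^{−|k|²} d⁴k = M₂²M₀²` for `a ≠ b`. [folklore] -/
private theorem integral_sq_mul_sq_mul_gauss4 {a b : Fin 4} (hab : a ≠ b) :
    ∫ k : Fin 4 → ℝ, (k a) ^ 2 * (k b) ^ 2 * gauss4 k = gaussMoment 2 ^ 2 * gaussMoment 0 ^ 2 := by
  have h := integral_monomial_mul_gauss4 (fun i => if i = a then 2 else if i = b then 2 else 0)
  have h2 : (fun k : Fin 4 → ℝ => (k a) ^ 2 * (k b) ^ 2 * gauss4 k) =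
      fun k => (∏ i, (k i) ^ (if i = a then 2 else if i = b then 2 else 0)) * gauss4 k := by
    funext k
    rw [sq_mul_sq_eq_prod k hab]
  rw [h2, h]
  fin_cases a <;> fin_cases b <;> simp at hab ⊢ <;> simp [Fin.prod_univ_four] <;> ring

/-- `∫ k_a² e^{−|k|²} d⁴k = M₂M₀³`. [folklore] -/
private theorem integral_sq_mul_gauss4 (a : Fin 4) :
    ∫ k : Fin 4 → ℝ, (k a) ^ 2 * gauss4 k = gaussMoment 2 * gaussMoment 0 ^ 3 := by
  have h := integral_monomial_mul_gauss4 (fun i => if i = a then 2 else 0)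
  have h2 : (fun k : Fin 4 → ℝ => (k a) ^ 2 * gauss4 k) =
      fun k => (∏ i, (k i) ^ (if i = a then 2 else 0)) * gauss4 k := by
    funext k
    rw [Finset.prod_eq_single a]
    · simp
    · intro b _ hb
      simp [hb]
    · simp
  rw [h2, h]
  fin_cases a <;> simp [Fin.prod_univ_four] <;> ring

/-- `k_a⁴ e^{−|k|²}` is integrable on `ℝ⁴`. [folklore] -/
private theorem integrable_fourth_mul_gauss4 (a : Fin 4) :
    Integrable (fun k : Fin 4 → ℝ => (k a) ^ 4 * gauss4 k) := by
  have h := integrable_monomial_mul_gauss4 (fun i => if i = a then 4 else 0)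
  refine h.congr ?_
  filter_upwards with k
  rw [pow_four_eq_prod]

/-- `k_a² k_b² e^{−|k|²}` is integrable on `ℝ⁴` (any `a, b`). [folklore] -/
private theorem integrable_sq_mul_sq_mul_gauss4 (a b : Fin 4) :
    Integrable (fun k : Fin 4 → ℝ => (k a) ^ 2 * (k b) ^ 2 * gauss4 k) := by
  by_cases hab : a = b
  · subst hab
    have h := integrable_fourth_mul_gauss4 a
    refine h.congr ?_
    filter_upwards with k
    ring
  · have h := integrable_monomial_mul_gauss4 (fun i => if i = a then 2 else if i = b then 2 else 0)
    refine h.congr ?_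
    filter_upwards with k
    rw [sq_mul_sq_eq_prod k hab]

/-- `k_a² e^{−|k|²}` is integrable on `ℝ⁴`. [folklore] -/
private theorem integrable_sq_mul_gauss4 (a : Fin 4) :
    Integrable (fun k : Fin 4 → ℝ => (k a) ^ 2 * gauss4 k) := by
  have h := integrable_monomial_mul_gauss4 (fun i => if i = a then 2 else 0)
  refine h.congr ?_
  filter_upwards with k
  rw [Finset.prod_eq_single a]
  · simp
  · intro b _ hb
    simp [hb]
  · simp

/-- `∫ |k|² e^{−|k|²} d⁴k = 4 M₂M₀³`. [folklore] -/
private theorem integral_normSq_mul_gauss4 :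
    ∫ k : Fin 4 → ℝ, normSq k * gauss4 k = 4 * (gaussMoment 2 * gaussMoment 0 ^ 3) := by
  have : (fun k : Fin 4 → ℝ => normSq k * gauss4 k) = fun k => ∑ a, (k a) ^ 2 * gauss4 k := by
    funext k
    rw [normSq, Finset.sum_mul]
  rw [this, integral_finsetSum _ (fun a _ => integrable_sq_mul_gauss4 a)]
  simp [integral_sq_mul_gauss4]

/-- `∫ |k|⁴ e^{−|k|²} d⁴k = 4 M₄M₀³ + 12 M₂²M₀²`. [folklore] -/
private theorem integral_normSq_sq_mul_gauss4 :
    ∫ k : Fin 4 → ℝ, normSq k ^ 2 * gauss4 k =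
      4 * (gaussMoment 4 * gaussMoment 0 ^ 3) + 12 * (gaussMoment 2 ^ 2 * gaussMoment 0 ^ 2) := by
  have : (fun k : Fin 4 → ℝ => normSq k ^ 2 * gauss4 k) =
      fun k => ∑ a, ∑ b, (k a) ^ 2 * (k b) ^ 2 * gauss4 k := by
    funext k
    rw [normSq, sq, Finset.sum_mul_sum, Finset.sum_mul]
    refine Finset.sum_congr rfl (fun a _ => ?_)
    rw [Finset.sum_mul]
  rw [this, integral_finsetSum _ (fun a _ => ?_)]
  · have inner : ∀ a : Fin 4, ∫ k : Fin 4 → ℝ, ∑ b, (k a) ^ 2 * (k b) ^ 2 * gauss4 k =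
        ∑ b, (if a = b then gaussMoment 4 * gaussMoment 0 ^ 3 else gaussMoment 2 ^ 2 * gaussMoment 0 ^ 2) := by
      intro a
      rw [integral_finsetSum _ (fun b _ => integrable_sq_mul_sq_mul_gauss4 a b)]
      refine Finset.sum_congr rfl (fun b _ => ?_)
      split_ifs with hab
      · subst hab
        rw [← integral_fourth_mul_gauss4 a]
        congr 1
        funext k
        ring
      · exact integral_sq_mul_sq_mul_gauss4 hab
    simp_rw [inner]
    simp [Fin.sum_univ_four]
    ring
  · exact integrable_finsetSum _ (fun b _ => integrable_sq_mul_sq_mul_gauss4 a b)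

/-- **Conversion rate `k_μ² ↔ k²/4`** («Euclidean symmetry», used for `G′₃`: `−2k₁²/k⁴ = −½/k²`,
p.350): `∫ k_a² e^{−|k|²} = ¼ ∫ |k|² e^{−|k|²}`. [cite: MagnenRivasseauSeneor1993, §III p.350] -/
theorem convRate_sq (a : Fin 4) :
    ∫ k : Fin 4 → ℝ, (k a) ^ 2 * gauss4 k = (1 / 4) * ∫ k : Fin 4 → ℝ, normSq k * gauss4 k := by
  rw [integral_sq_mul_gauss4, integral_normSq_mul_gauss4]
  ring

/-- **Conversion rate `k₁⁴ ↔ (k²)²/8`** («Applying the same conversion rate, we obtain in units of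
`(k²)²` a final combinatoric factor of −1.5» from `−12k₁⁴`, p.350): `∫ k_a⁴ e^{−|k|²} = ⅛ ∫ |k|⁴ e^{−|k|²}`.
[cite: MagnenRivasseauSeneor1993, §III p.350] -/
theorem convRate_fourth (a : Fin 4) :
    ∫ k : Fin 4 → ℝ, (k a) ^ 4 * gauss4 k = (1 / 8) * ∫ k : Fin 4 → ℝ, normSq k ^ 2 * gauss4 k := by
  rw [integral_fourth_mul_gauss4, integral_normSq_sq_mul_gauss4, gaussMoment_zero, gaussMoment_two,
    gaussMoment_four]
  have hπ : √π ^ 2 = π := Real.sq_sqrt pi_pos.le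
  nlinarith [hπ]

/-- **Conversion rate `k₁²k₂² ↔ (k²)²/24`** (the mixed term of the `G₂`, `G₃` contractions):
`∫ k_a²k_b² e^{−|k|²} = (1/24) ∫ |k|⁴ e^{−|k|²}` for `a ≠ b`. [cite: MagnenRivasseauSeneor1993, §III p.349–350] -/
theorem convRate_sq_sq {a b : Fin 4} (hab : a ≠ b) :
    ∫ k : Fin 4 → ℝ, (k a) ^ 2 * (k b) ^ 2 * gauss4 k =
      (1 / 24) * ∫ k : Fin 4 → ℝ, normSq k ^ 2 * gauss4 k := by
  rw [integral_sq_mul_sq_mul_gauss4 hab, integral_normSq_sq_mul_gauss4, gaussMoment_zero, gaussMoment_two,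
    gaussMoment_four]
  have hπ : √π ^ 2 = π := Real.sq_sqrt pi_pos.le
  nlinarith [hπ]

/-! ## §2 The four `A⁴` graphs, AS PRINTED (`t = 1/ζ − 1`) -/

/-- Graph `G₁` (p.349 tl.8–10): «a positive coefficient `3·4(3 + 3(1/ζ−1)/2 + 5(1/ζ−1)²/8)`».
[cite: MagnenRivasseauSeneor1993, §III p.349] -/
def G1 (t : ℝ) : ℝ := 3 * 4 * (3 + 3 * t / 2 + 5 * t ^ 2 / 8)

/-- Graph `G₂` (p.349 tl.29–30): «equivalent by Euclidean symmetry to `−90 − 45(1/ζ−1) − 15(1/ζ−1)²`».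
[cite: MagnenRivasseauSeneor1993, §III p.349] -/
def G2 (t : ℝ) : ℝ := -90 - 45 * t - 15 * t ^ 2

/-- Graph `G₃` (p.350 tl.3–4): «a final factor … of `6(9 + 1/4 + 9(1/ζ−1)/2 + 5(1/ζ−1)²/4)`».
[cite: MagnenRivasseauSeneor1993, §III p.350] -/
def G3 (t : ℝ) : ℝ := 6 * (9 + 1 / 4 + 9 * t / 2 + 5 * t ^ 2 / 4)

/-- Graph `G₄`, the ghost loop (p.350 tl.10–12): «the contribution is `−12k₁⁴` … Applying the same
conversion rate, we obtain in units of `(k²)²` a final combinatoric factor of `−1.5`» — typed as the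
pre-conversion number `−12` times the conversion rate `⅛` of `convRate_fourth`.
[cite: MagnenRivasseauSeneor1993, §III p.350] -/
def G4 : ℝ := -12 * (1 / 8)

/-- p.349 tl.9–10: `3·4(3 + 3t/2 + 5t²/8) = 36 + 18t + 15t²/2`. [cite: MagnenRivasseauSeneor1993, §III p.349] -/
theorem G1_eq (t : ℝ) : G1 t = 36 + 18 * t + 15 * t ^ 2 / 2 := by
  unfold G1; ring

/-- p.350 tl.3–4: `6(9 + ¼ + 9t/2 + 5t²/4) = 55.5 + 27t + 7.5t²`. [cite: MagnenRivasseauSeneor1993, §III p.350] -/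
theorem G3_eq (t : ℝ) : G3 t = 55.5 + 27 * t + 7.5 * t ^ 2 := by
  unfold G3; ring

/-- p.350 tl.12: `−12 · ⅛ = −1.5`. [cite: MagnenRivasseauSeneor1993, §III p.350] -/
theorem G4_eq : G4 = -1.5 := by
  unfold G4; norm_num

/-! ## §3 «the famous miracle of renormalizability (at one loop...)» -/

/-- p.350 tl.13–15: «Remark that when the cutoff is 1 we can all add the terms together and the 4
coefficients add up to 0. This is a particular case of the famous miracle of renormalizability (at one
loop...) of four dimensional gauge theories.» — for EVERY value of the gauge parameter.
[cite: MagnenRivasseauSeneor1993, §III p.350] -/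
theorem one_loop_A4_sum_eq_zero (t : ℝ) : G1 t + G2 t + G3 t + G4 = 0 := by
  unfold G1 G2 G3 G4; ring

/-- The same, order by order in `t = 1/ζ − 1`: constants `36 − 90 + 55.5 − 1.5`, linear `18 − 45 + 27`,
quadratic `7.5 − 15 + 7.5`. [cite: MagnenRivasseauSeneor1993, §III p.350] -/
theorem one_loop_A4_sum_by_order :
    (36 : ℝ) - 90 + 55.5 - 1.5 = 0 ∧ (18 : ℝ) - 45 + 27 = 0 ∧ (7.5 : ℝ) - 15 + 7.5 = 0 := by
  norm_num

/-! ## §4 The three `A²` graphs, AS PRINTED -/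

/-- Graph `G′₁` (p.350 tl.21–23): «the contribution is `−6(1 + (1/ζ−1)/4)`».
[cite: MagnenRivasseauSeneor1993, §III p.350] -/
def G1' (t : ℝ) : ℝ := -6 * (1 + t / 4)

/-- Graph `G′₂` (p.350 tl.24–26): «`= (9/2 + 6(1/ζ−1)/4)`». [cite: MagnenRivasseauSeneor1993, §III p.350] -/
def G2' (t : ℝ) : ℝ := 9 / 2 + 6 * t / 4

/-- Graph `G′₃`, the ghost loop (p.350 tl.27–31): «The contributions is therefore `−2k₁²/k⁴ = −(1/2)/k²`»
— typed as `−2` times the conversion rate `¼` of `convRate_sq`. [cite: MagnenRivasseauSeneor1993, §III p.350] -/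
def G3' : ℝ := -2 * (1 / 4)

/-- p.350 tl.30–31: `−2k₁²/k⁴ = −(1/2)/k²`, i.e. `−2 · ¼ = −½`. [cite: MagnenRivasseauSeneor1993, §III p.350] -/
theorem G3'_eq : G3' = -(1 / 2) := by
  unfold G3'; norm_num

/-- p.350 tl.32–34: «The result for the `(A²/2)` term in the region where the ultraviolet cutoff is one
is obtained by adding all the terms and is `−6 − 6/4(1/ζ−1) − 1/2 + 9/2 + 6/4(1/ζ−1) = −2` times the
loop integration. Remark that this result is independent of `ζ`.» [cite: MagnenRivasseauSeneor1993, §III p.350] -/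
theorem one_loop_A2_sum (t : ℝ) : G1' t + G3' + G2' t = -2 := by
  unfold G1' G2' G3'; ring

/-- The printed intermediate expression, verbatim: `−6 − (6/4)t − 1/2 + 9/2 + (6/4)t = −2`.
[cite: MagnenRivasseauSeneor1993, §III p.350] -/
theorem one_loop_A2_sum_printed (t : ℝ) :
    (-6 : ℝ) - 6 / 4 * t - 1 / 2 + 9 / 2 + 6 / 4 * t = -2 := by
  ring

/-! ## §5 The cutoff (II.14): the plateau at height `½` and the `|ln η|` coefficient (III.6) -/

/-- The plateau part of the cutoff (II.14) p.331: «`κ(p) = 1/2` if `2 ≤ |p| ≤ 2 + η⁻¹`» — on the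
plateau `κⁿ = 2⁻ⁿ`; a graph with `n` propagators carries `κⁿ`. [cite: MagnenRivasseauSeneor1993, (II.14) p.331] -/
def plateauWeight (n : ℕ) : ℝ := (1 / 2) ^ n

/-- The radial plateau integral: `∫_2^{2+η⁻¹} κ(r)ⁿ dr/r = 2⁻ⁿ log((2 + η⁻¹)/2)` (the `d⁴p/p⁴` measure of
(III.4) is `|S³| dr/r` in polar coordinates). [cite: MagnenRivasseauSeneor1993, (II.14) p.331, (III.4) p.351] -/
theorem plateau_radial_integral {η : ℝ} (hη : 0 < η) (n : ℕ) :
    ∫ r in (2 : ℝ)..(2 + η⁻¹), plateauWeight n / r = plateauWeight n * Real.log ((2 + η⁻¹) / 2) := by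
  have h2 : (0 : ℝ) < 2 := two_pos
  have h3 : (0 : ℝ) < 2 + η⁻¹ := by positivity
  simp_rw [div_eq_mul_one_div (plateauWeight n)]
  rw [intervalIntegral.integral_const_mul, integral_one_div_of_pos h2 h3]

/-- `log((2 + η⁻¹)/2) = −log η + log((1 + 2η)/2)`: the plateau contributes `|ln η|` up to a bounded term.
[cite: MagnenRivasseauSeneor1993, (III.6) p.352] -/
theorem log_plateau_eq {η : ℝ} (hη : 0 < η) :
    Real.log ((2 + η⁻¹) / 2) = -Real.log η + Real.log ((1 + 2 * η) / 2) := by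
  have hη' : η ≠ 0 := hη.ne'
  have : (2 + η⁻¹) / 2 = ((1 + 2 * η) / 2) * η⁻¹ := by
    field_simp
    ring
  rw [this, Real.log_mul (by positivity) (inv_ne_zero hη'), Real.log_inv]
  ring

/-- The bounded term: for `0 < η ≤ ½`, `|log((1 + 2η)/2)| ≤ log 2` («finite terms … uniformly bounded … as
`η` tends to 0», p.352 tl.7–8). [cite: MagnenRivasseauSeneor1993, (III.6) p.352] -/
theorem abs_log_plateau_remainder_le {η : ℝ} (hη : 0 < η) (hη2 : η ≤ 1 / 2) :
    |Real.log ((1 + 2 * η) / 2)| ≤ Real.log 2 := by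
  have hlo : (1 : ℝ) / 2 ≤ (1 + 2 * η) / 2 := by linarith
  have hhi : (1 + 2 * η) / 2 ≤ 1 := by linarith
  have hpos : (0 : ℝ) < (1 + 2 * η) / 2 := by positivity
  have hle0 : Real.log ((1 + 2 * η) / 2) ≤ 0 := Real.log_nonpos hpos.le hhi
  have hge : Real.log (1 / 2) ≤ Real.log ((1 + 2 * η) / 2) := Real.log_le_log (by norm_num) hlo
  rw [abs_of_nonpos hle0]
  have : Real.log (1 / 2) = -Real.log 2 := by
    rw [one_div, Real.log_inv]
  linarith

/-- Hence `|∫_2^{2+η⁻¹} κⁿ dr/r − 2⁻ⁿ|ln η|| ≤ 2⁻ⁿ log 2` for `0 < η ≤ ½` (`|ln η| = −log η` there).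
[cite: MagnenRivasseauSeneor1993, (II.14) p.331, (III.6) p.352] -/
theorem plateau_radial_integral_sub_le {η : ℝ} (hη : 0 < η) (hη2 : η ≤ 1 / 2) (n : ℕ) :
    |(∫ r in (2 : ℝ)..(2 + η⁻¹), plateauWeight n / r) - plateauWeight n * (-Real.log η)| ≤
      plateauWeight n * Real.log 2 := by
  rw [plateau_radial_integral hη, log_plateau_eq hη]
  have hw : 0 ≤ plateauWeight n := by unfold plateauWeight; positivity
  rw [show plateauWeight n * (-Real.log η + Real.log ((1 + 2 * η) / 2)) - plateauWeight n * -Real.log η =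
      plateauWeight n * Real.log ((1 + 2 * η) / 2) by ring, abs_mul, abs_of_nonneg hw]
  exact mul_le_mul_of_nonneg_left (abs_log_plateau_remainder_le hη hη2) hw

/-- The plateau-shell integrand of the one-loop integrals (III.4) in `d = 4`: `κ(p)ⁿ/|p|⁴` restricted to the
plateau `2 ≤ |p| ≤ 2 + η⁻¹` of (II.14), as a function of `r = |p|`.
[cite: MagnenRivasseauSeneor1993, (II.14) p.331, (III.4) p.351] -/
def shellIntegrand (η : ℝ) (n : ℕ) (r : ℝ) : ℝ :=
  if 2 ≤ r ∧ r ≤ 2 + η⁻¹ then plateauWeight n / r ^ 4 else 0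

/-- `|S³| = 2π²`: `dim ℝ⁴ · vol(B⁴) = 4 · π²/2`. [folklore] -/
private theorem volume_real_ball_four :
    (volume : Measure (EuclideanSpace ℝ (Fin 4))).real (ball 0 1) = π ^ 2 / 2 := by
  have hdim : Module.finrank ℝ (EuclideanSpace ℝ (Fin 4)) = 2 * 2 := by
    rw [finrank_euclideanSpace_fin]
  rw [measureReal_def, InnerProductSpace.volume_ball_of_dim_even hdim, hdim]
  simp only [ENNReal.ofReal_one, one_pow, one_mul, Nat.factorial_two, Nat.cast_ofNat]
  rw [ENNReal.toReal_ofReal (by positivity)]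

/-- **The plateau part of `∫ d⁴p κ(p)ⁿ/p⁴`** (the measure of (III.4)) over `2 ≤ |p| ≤ 2 + η⁻¹` equals
`2π² · 2⁻ⁿ · log((2 + η⁻¹)/2) = 2π² · 2⁻ⁿ(|ln η| + O(1))` — the mechanism behind the weights `¼, ⅛, 1/16`
of (III.6) for the graphs with 2, 3, 4 propagators. [cite: MagnenRivasseauSeneor1993, (II.14) p.331, (III.4)–(III.6) pp.351–352] -/
theorem integral_shell_eq {η : ℝ} (hη : 0 < η) (n : ℕ) :
    ∫ p : EuclideanSpace ℝ (Fin 4), shellIntegrand η n ‖p‖ =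
      2 * π ^ 2 * (plateauWeight n * Real.log ((2 + η⁻¹) / 2)) := by
  rw [integral_fun_norm_addHaar volume (shellIntegrand η n), volume_real_ball_four, finrank_euclideanSpace_fin]
  have hI : ∫ y in Ioi (0 : ℝ), y ^ (4 - 1) • shellIntegrand η n y =
      plateauWeight n * Real.log ((2 + η⁻¹) / 2) := by
    have h41 : (4 - 1 : ℕ) = 3 := rfl
    have heq : (fun y : ℝ => y ^ (4 - 1) • shellIntegrand η n y) =
        (Icc 2 (2 + η⁻¹)).indicator (fun y => plateauWeight n / y) := by
      funext y
      by_cases h : 2 ≤ y ∧ y ≤ 2 + η⁻¹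
      · have hy : (0 : ℝ) < y := lt_of_lt_of_le two_pos h.1
        have hmem : y ∈ Icc (2 : ℝ) (2 + η⁻¹) := h
        simp only [Set.indicator, hmem, if_true, shellIntegrand, if_pos h, smul_eq_mul, h41]
        field_simp
      · have hnmem : y ∉ Icc (2 : ℝ) (2 + η⁻¹) := h
        simp only [Set.indicator, hnmem, if_false, shellIntegrand, if_neg h, smul_zero]
    rw [heq, setIntegral_indicator measurableSet_Icc,
      show Ioi (0 : ℝ) ∩ Icc 2 (2 + η⁻¹) = Icc 2 (2 + η⁻¹) from
        inter_eq_right.mpr (fun y hy => lt_of_lt_of_le two_pos hy.1),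
      integral_Icc_eq_integral_Ioc,
      ← intervalIntegral.integral_of_le (by linarith [inv_pos.mpr hη] : (2 : ℝ) ≤ 2 + η⁻¹),
      plateau_radial_integral hη]
  rw [hI]
  simp only [nsmul_eq_mul, smul_eq_mul, Nat.cast_ofNat]
  ring

/-- The `|ln η|`-coefficient of the one-loop `(A⁴/24)` term assembled from (III.4): graph `G₁` has two
propagators (`κ²`), `G₂` three (`κ³`), `G₃` and `G₄` four (`κ⁴`), each `κⁿ` contributing its plateau
weight `2⁻ⁿ` per unit of `|ln η|`. [cite: MagnenRivasseauSeneor1993, (III.4)–(III.6) pp.351–352] -/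
def lnEtaCoeff (t : ℝ) : ℝ :=
  plateauWeight 2 * G1 t + plateauWeight 3 * G2 t + plateauWeight 4 * (G3 t + G4)

/-- **(III.6)** p.352 tl.2–6: «As a consequence the one loop `(A⁴/24)` contribution behaves as
`[(36 + 18(1/ζ−1) + 7.5(1/ζ−1)²)/4 − (90 + 45(1/ζ−1) + 15(1/ζ−1)²)/8 + (54 + 27(1/ζ−1) + 7.5(1/ζ−1)²)/16](−ln η)
+ finite terms = 9/8(1 + (1/ζ−1)/2 + 5/12(1/ζ−1)²)|ln η| + finite terms`».
[cite: MagnenRivasseauSeneor1993, (III.6) p.352] -/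
theorem lnEtaCoeff_eq (t : ℝ) : lnEtaCoeff t = 9 / 8 * (1 + t / 2 + 5 / 12 * t ^ 2) := by
  unfold lnEtaCoeff plateauWeight G1 G2 G3 G4
  ring

/-- The bracket of (III.6) with the printed graph totals (`54 = 55.5 − 1.5` for `κ⁴`).
[cite: MagnenRivasseauSeneor1993, (III.4) p.351, (III.6) p.352] -/
theorem lnEtaCoeff_eq_printed_bracket (t : ℝ) :
    lnEtaCoeff t = (36 + 18 * t + 7.5 * t ^ 2) / 4 - (90 + 45 * t + 15 * t ^ 2) / 8
      + (54 + 27 * t + 7.5 * t ^ 2) / 16 := by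
  unfold lnEtaCoeff plateauWeight G1 G2 G3 G4
  ring

/-- (III.4) ⇒ (III.6) on the plateau, assembled in `d = 4`: weighting each printed graph total by its shell integral
`∫ κⁿ d⁴p/p⁴` (`n` = number of propagators: 2 for `G₁`, 3 for `G₂`, 4 for `G₃`, `G₄`) gives
`2π² · 9/8(1 + t/2 + 5t²/12) · log((2 + η⁻¹)/2)` — i.e. `9/8(…)|ln η|` up to the normalisation `2π² = |S³|` of `∫d⁴p/p⁴`
and a bounded term. [cite: MagnenRivasseauSeneor1993, (III.4) p.351, (III.6) p.352] -/
theorem one_loop_A4_shell_eq {η : ℝ} (hη : 0 < η) (t : ℝ) :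
    G1 t * (∫ p : EuclideanSpace ℝ (Fin 4), shellIntegrand η 2 ‖p‖)
      + G2 t * (∫ p : EuclideanSpace ℝ (Fin 4), shellIntegrand η 3 ‖p‖)
      + (G3 t + G4) * (∫ p : EuclideanSpace ℝ (Fin 4), shellIntegrand η 4 ‖p‖) =
      2 * π ^ 2 * (9 / 8 * (1 + t / 2 + 5 / 12 * t ^ 2)) * Real.log ((2 + η⁻¹) / 2) := by
  rw [integral_shell_eq hη, integral_shell_eq hη, integral_shell_eq hη, ← lnEtaCoeff_eq]
  unfold lnEtaCoeff
  ring

/-! ## §6 The sign analysis p.352 and the stabilizing counterterm (III.7) -/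

/-- p.352 tl.8–9: «The polynomial `1 + (1/ζ−1)/2 + (5/12)(1/ζ−1)²` is always positive and greater than
`17/20`» — `≥ 17/20` for every real `t = 1/ζ − 1`. [cite: MagnenRivasseauSeneor1993, §III p.352] -/
theorem signPoly_ge (t : ℝ) : 17 / 20 ≤ 1 + t / 2 + 5 / 12 * t ^ 2 := by
  nlinarith [sq_nonneg (t + 3 / 5)]

/-- Precision (ours): `17/20` IS the minimum, attained exactly at `t = −3/5`, i.e. `ζ = 5/2`; the print's
«greater than» holds strictly for every other `ζ`. [cite: MagnenRivasseauSeneor1993, §III p.352] -/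
theorem signPoly_eq_iff (t : ℝ) : 1 + t / 2 + 5 / 12 * t ^ 2 = 17 / 20 ↔ t = -(3 / 5) := by
  constructor
  · intro h
    have : 5 / 12 * (t + 3 / 5) ^ 2 = 0 := by nlinarith [sq_nonneg (t + 3 / 5)]
    have h2 : (t + 3 / 5) ^ 2 = 0 := by linarith
    have h3 : t + 3 / 5 = 0 := pow_eq_zero_iff (n := 2) (by norm_num) |>.mp h2
    linarith
  · rintro rfl
    norm_num

/-- «greater than 17/20» strictly, for every `ζ ≠ 5/2`. [cite: MagnenRivasseauSeneor1993, §III p.352] -/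
theorem signPoly_gt_of_ne {t : ℝ} (ht : t ≠ -(3 / 5)) : 17 / 20 < 1 + t / 2 + 5 / 12 * t ^ 2 := by
  rcases (signPoly_ge t).lt_or_eq with h | h
  · exact h
  · exact absurd ((signPoly_eq_iff t).mp h.symm) ht

/-- «always positive». [cite: MagnenRivasseauSeneor1993, §III p.352] -/
theorem signPoly_pos (t : ℝ) : 0 < 1 + t / 2 + 5 / 12 * t ^ 2 :=
  lt_of_lt_of_le (by norm_num) (signPoly_ge t)

/-- p.352 tl.9: «Since `(17/20) · (9/8) ≥ 1/2`» — indeed `= 153/160 > 1/2`. [cite: MagnenRivasseauSeneor1993, §III p.352] -/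
theorem key_product_gt_half : (1 : ℝ) / 2 < 17 / 20 * (9 / 8) ∧ (17 : ℝ) / 20 * (9 / 8) = 153 / 160 := by
  norm_num

/-- Hence the `|ln η|`-coefficient of the one-loop `A⁴/24` term is `≥ 153/160 > ½` in EVERY gauge `ζ`.
[cite: MagnenRivasseauSeneor1993, (III.6) p.352] -/
theorem lnEtaCoeff_ge (t : ℝ) : 153 / 160 ≤ lnEtaCoeff t := by
  rw [lnEtaCoeff_eq]
  nlinarith [signPoly_ge t]

/-- The `|ln η|`-coefficient exceeds `½` in every gauge. [cite: MagnenRivasseauSeneor1993, (III.6)–(III.7) p.352] -/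
theorem half_lt_lnEtaCoeff (t : ℝ) : 1 / 2 < lnEtaCoeff t :=
  lt_of_lt_of_le (by norm_num) (lnEtaCoeff_ge t)

/-- **(III.7)** p.352 tl.9–13: «taking `η` small enough (depending on the details of our cutoff, which are
responsible for the particular value of the finite terms) we can always achieve our goal of a positive
total `A⁴` contribution, hence of a negative stabilizing counterterm, with value at least
`e^{−(1/2)∫_Λ(A⁴/24)|ln η|}`» — quantitatively, for the coefficient in the exponent: if the finite terms are bounded by `C` and
`|ln η| ≥ 160C/73`, the total one-loop `A⁴/24` coefficient `c(ζ)|ln η| + F` is `≥ ½|ln η|`, for every `ζ`.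
[cite: MagnenRivasseauSeneor1993, (III.7) p.352] -/
theorem stabilizing_coefficient_ge_half (t : ℝ) {F C Λ : ℝ} (hF : |F| ≤ C) (hΛ : 160 * C / 73 ≤ Λ) :
    1 / 2 * Λ ≤ lnEtaCoeff t * Λ + F := by
  have hc := lnEtaCoeff_ge t
  have hC : 0 ≤ C := le_trans (abs_nonneg F) hF
  have hΛ0 : 0 ≤ Λ := le_trans (by positivity) hΛ
  have hF' : -C ≤ F := by
    have := neg_abs_le F
    linarith
  nlinarith

/-- The same with `Λ = |ln η| = −log η` for `0 < η ≤ exp(−160C/73)` («if `η` is small enough»).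
[cite: MagnenRivasseauSeneor1993, (III.7) p.352] -/
theorem stabilizing_coefficient_ge_half_log (t : ℝ) {F C η : ℝ} (hF : |F| ≤ C) (hη : 0 < η)
    (hsmall : η ≤ Real.exp (-(160 * C / 73))) :
    1 / 2 * (-Real.log η) ≤ lnEtaCoeff t * (-Real.log η) + F := by
  refine stabilizing_coefficient_ge_half t hF ?_
  have h := Real.log_le_log hη hsmall
  rw [Real.log_exp] at h
  linarith

/-- p.352 tl.14–15: «Remark that the coefficient of this stabilizing term can be made as large as we want,
if `η` is small enough»: for every target `K` and finite-term bound `C`, `η ≤ exp(−(K + C)·160/153)` gives a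
total coefficient `≥ K`. [cite: MagnenRivasseauSeneor1993, §III p.352] -/
theorem stabilizing_coefficient_large (t : ℝ) {F C K η : ℝ} (hF : |F| ≤ C) (hK : 0 ≤ K) (hη : 0 < η)
    (hsmall : η ≤ Real.exp (-((K + C) * 160 / 153))) :
    K ≤ lnEtaCoeff t * (-Real.log η) + F := by
  have hc := lnEtaCoeff_ge t
  have hC : 0 ≤ C := le_trans (abs_nonneg F) hF
  have h := Real.log_le_log hη hsmall
  rw [Real.log_exp] at h
  have hL : (K + C) * 160 / 153 ≤ -Real.log η := by linarith
  have hF' : -C ≤ F := by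
    have := neg_abs_le F
    linarith
  have hL0 : 0 ≤ -Real.log η := le_trans (by positivity) hL
  nlinarith


/-! ## §7 (v1.1) The homothetic gauge: `ζ = 3/13` kills the one-loop wave function renormalization -/

/-- p.333 tl.1–2: «the one loop wave function renormalization is proportional to `10/3 + (1 − 1/ζ)`» — the printed
coefficient, as a function of the gauge parameter `ζ` (the proportionality constant, a one-loop computation of [IZ], is
not formalised). [cite: MagnenRivasseauSeneor1993, §II.B p.333] -/
def waveFunctionCoeff (ζ : ℝ) : ℝ := 10 / 3 + (1 - 1 / ζ)

/-- In the variable `t = 1/ζ − 1` of §§2–6 the coefficient reads `10/3 − t`. [cite: MagnenRivasseauSeneor1993, §II.B p.333] -/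
theorem waveFunctionCoeff_eq (ζ : ℝ) : waveFunctionCoeff ζ = 10 / 3 - (1 / ζ - 1) := by
  unfold waveFunctionCoeff; ring

/-- **p.333 tl.2: «hence vanishes for `ζ = 3/13`»** — and ONLY there: `10/3 + (1 − 1/ζ) = 0 ↔ ζ = 3/13` (for `ζ = 0`
Lean's `1/0 = 0` gives the value `13/3 ≠ 0`, so no side condition is needed). [cite: MagnenRivasseauSeneor1993, §II.B p.333] -/
theorem waveFunctionCoeff_eq_zero_iff (ζ : ℝ) : waveFunctionCoeff ζ = 0 ↔ ζ = 3 / 13 := by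
  unfold waveFunctionCoeff
  constructor
  · intro h
    have hζ : ζ ≠ 0 := by
      rintro rfl
      norm_num at h
    field_simp at h
    linarith
  · rintro rfl
    norm_num

/-- p.332 tl.37–39 / p.333 tl.2–4: «a value close to 3/13 … vanishing … either exactly 0 or as small as we want»: the
coefficient at the printed value is exactly `0`. [cite: MagnenRivasseauSeneor1993, §II.B pp.332–333] -/
theorem waveFunctionCoeff_homothetic : waveFunctionCoeff (3 / 13) = 0 :=
  (waveFunctionCoeff_eq_zero_iff _).2 rfl

/-- The sign around the root (ours, for «as small as we want» with either sign): for `ζ > 0`,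
`10/3 + (1 − 1/ζ) > 0 ↔ ζ > 3/13`. [cite: MagnenRivasseauSeneor1993, §II.B p.333] -/
theorem waveFunctionCoeff_pos_iff {ζ : ℝ} (hζ : 0 < ζ) : 0 < waveFunctionCoeff ζ ↔ 3 / 13 < ζ := by
  unfold waveFunctionCoeff
  rw [show (10 : ℝ) / 3 + (1 - 1 / ζ) = (13 * ζ - 3) / (3 * ζ) by field_simp; ring]
  rw [div_pos_iff_of_pos_right (by positivity)]
  constructor <;> intro h <;> linarith

/-- In the Feynman gauge `ζ = 1` the coefficient is `10/3` (no cancellation). [cite: MagnenRivasseauSeneor1993, §II.B p.333] -/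
theorem waveFunctionCoeff_feynman : waveFunctionCoeff 1 = 10 / 3 := by
  unfold waveFunctionCoeff; norm_num

/-! ## §8 (v1.1) Sect. VI: the hyperspherical angular averages and the first order in `β` — (VI.17)–(VI.19) -/

/-- The normalisation of the `θ`-measure of p.372 tl.9–10 («`d⁴p` is proportional to `M^{4i} u du sin²θ sinφ dθ dφ`»,
used as `(2/π)∫₀^π sin²θ dθ`): `∫₀^π sin²θ dθ = π/2`. [cite: MagnenRivasseauSeneor1993, §VI p.372] -/
theorem integral_sin_sq_zero_pi : ∫ θ in (0 : ℝ)..π, Real.sin θ ^ 2 = π / 2 := by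
  rw [integral_sin_sq]
  simp

/-- The normalisation of the `φ`-measure (`(1/2)∫₀^π sinφ dφ`): `∫₀^π sinφ dφ = 2`. [cite: MagnenRivasseauSeneor1993, §VI p.372] -/
theorem integral_sin_zero_pi : ∫ φ in (0 : ℝ)..π, Real.sin φ = 2 := by
  rw [integral_sin]
  norm_num

/-- `∫₀^π sin²θ cos²θ dθ = π/8`. [cite: MagnenRivasseauSeneor1993, §VI (VI.18) p.373] -/
theorem integral_sin_sq_mul_cos_sq_zero_pi : ∫ θ in (0 : ℝ)..π, Real.sin θ ^ 2 * Real.cos θ ^ 2 = π / 8 := by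
  rw [integral_sin_sq_mul_cos_sq]
  have h : Real.sin (4 * π) = 0 := by
    have := Real.sin_nat_mul_pi 4
    exact_mod_cast this
  rw [h]
  simp

/-- `∫₀^π sin⁴θ dθ = 3π/8`. [cite: MagnenRivasseauSeneor1993, §VI (VI.18) p.373] -/
theorem integral_sin_pow_four_zero_pi : ∫ θ in (0 : ℝ)..π, Real.sin θ ^ 4 = 3 * π / 8 := by
  have h := integral_sin_pow_even (n := 2)
  rw [show 2 * 2 = 4 from rfl] at h
  rw [h, Finset.prod_range_succ, Finset.prod_range_succ, Finset.prod_range_zero]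
  norm_num
  ring

/-- `∫₀^π cos²φ sinφ dφ = 2/3`. [cite: MagnenRivasseauSeneor1993, §VI (VI.18) p.373] -/
theorem integral_cos_sq_mul_sin_zero_pi : ∫ φ in (0 : ℝ)..π, Real.cos φ ^ 2 * Real.sin φ = 2 / 3 := by
  have h := integral_sin_pow_odd_mul_cos_pow (a := 0) (b := π) 0 2
  simp only [Nat.mul_zero, zero_add, pow_one, pow_zero, mul_one, Real.cos_pi, Real.cos_zero] at h
  rw [show (fun φ => Real.cos φ ^ 2 * Real.sin φ) = fun φ => Real.sin φ * Real.cos φ ^ 2 from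
    funext fun φ => mul_comm _ _]
  rw [h, integral_pow]
  norm_num

/-- **The angular average behind the Faddeev–Popov term of (VI.18)**: with the normalised measures
`(2/π) sin²θ dθ` on `[0,π]` and `(1/2) sinφ dφ` on `[0,π]`, `⟨cos²θ⟩ = ¼` and `⟨sin²θ⟩⟨cos²φ⟩ = ¾ · ⅓ = ¼`, so
`⟨cos²θ + t² sin²θ cos²φ⟩ = (1 + t²)/4` (the `k_μ²/k² ↦ ¼` conversion of Sect. III in hyperspherical coordinates).
[cite: MagnenRivasseauSeneor1993, §VI (VI.18) p.373] -/
theorem angularAverage_FP (t : ℝ) :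
    (2 / π) * (1 / 2) * ((∫ θ in (0 : ℝ)..π, Real.sin θ ^ 2 * Real.cos θ ^ 2) * (∫ φ in (0 : ℝ)..π, Real.sin φ)
      + t ^ 2 * ((∫ θ in (0 : ℝ)..π, Real.sin θ ^ 4) * (∫ φ in (0 : ℝ)..π, Real.cos φ ^ 2 * Real.sin φ))) =
      (1 + t ^ 2) / 4 := by
  rw [integral_sin_sq_mul_cos_sq_zero_pi, integral_sin_zero_pi, integral_sin_pow_four_zero_pi,
    integral_cos_sq_mul_sin_zero_pi]
  field_simp
  ring

/-- The first-order-in-`β` coefficient of the boson determinant, (VI.17) p.373 tl.27–29, AS PRINTED (per unit of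
`(β/2)(1+t²)`): the Sect.-III graphs `G′₁ = −6(1 + (1/ζ−1)/4)`, `G′₂ = κ(9/2 + (3/2)(1/ζ−1))` plus the «new vertex» graphs
`G″₁ = −2ζ(1 + (1/ζ−1)/4)`, `G″₂ = κ(−2 + (3/2)ζ)` of the background-dependent gauge fixing.
[cite: MagnenRivasseauSeneor1993, §VI (VI.17) p.373] -/
def bosonFirstOrder (ζ κ : ℝ) : ℝ :=
  -6 * (1 + (1 / ζ - 1) / 4) - 2 * ζ * (1 + (1 / ζ - 1) / 4) + κ * (9 / 2 + 3 / 2 * (1 / ζ - 1) - 2 + 3 / 2 * ζ)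

/-- The counterterm coefficient of (VI.16)/(VI.18) p.373, AS PRINTED (per unit of `(β/2)(1+t²)`):
`6(1 + (1/ζ−1)/4) − κ(4 + 3(1/ζ−1)/2)` (= minus the Sect.-III `A²` total `G′₁ + G′₂ + G′₃` weighted by `1, κ, κ`:
`−κ((9/2) + 6(1/ζ−1)/4) + κ/2 = −κ(4 + 3(1/ζ−1)/2)`, (VI.16)). [cite: MagnenRivasseauSeneor1993, §VI (VI.16), (VI.18) p.373] -/
def countertermFirstOrder (ζ κ : ℝ) : ℝ := 6 * (1 + (1 / ζ - 1) / 4) - κ * (4 + 3 * (1 / ζ - 1) / 2)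

/-- (VI.16): the counterterm's `κ`-part is the Sect.-III `A²` graphs `G′₂`, `G′₃` with the opposite sign:
`−κ(9/2 + 6(1/ζ−1)/4) + κ/2 = −κ(4 + 3(1/ζ−1)/2)`, and its `κ⁰`-part is `−G′₁`. [cite: MagnenRivasseauSeneor1993, §VI (VI.16) p.373] -/
theorem countertermFirstOrder_eq (ζ κ : ℝ) :
    countertermFirstOrder ζ κ = -G1' (1 / ζ - 1) - κ * G2' (1 / ζ - 1) - κ * G3' := by
  unfold countertermFirstOrder G1' G2' G3'
  ring

/-- The Faddeev–Popov determinant's first order per unit of `(β/2)(1+t²)`: `ln|1 − βκ[cos²θ + t² sin²θ cos²φ]|` averaged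
`≈ −βκ(1 + t²)/4 = (β/2)(1 + t²)·(−κ/2)` (`angularAverage_FP`). [cite: MagnenRivasseauSeneor1993, §VI (VI.18) p.373] -/
def fpFirstOrder (κ : ℝ) : ℝ := -κ / 2

/-- **(VI.18)** p.373 tl.37–42: adding the Faddeev–Popov term, the boson determinant (VI.17) and the counterterms gives, at
first order in `β` and per unit of `(β/2)(1 + t²)`, «`−3ζ/2 − 1/2 − κ(2 − (3/2)ζ)`» — an identity in `ζ ≠ 0` and `κ`.
[cite: MagnenRivasseauSeneor1993, §VI (VI.18) p.373] -/
theorem firstOrder_assembly {ζ : ℝ} (hζ : ζ ≠ 0) (κ : ℝ) :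
    fpFirstOrder κ + bosonFirstOrder ζ κ + countertermFirstOrder ζ κ = -3 * ζ / 2 - 1 / 2 - κ * (2 - 3 / 2 * ζ) := by
  unfold fpFirstOrder bosonFirstOrder countertermFirstOrder
  field_simp
  ring

/-- **(VI.19), a strict variant.** The page (p.374 tl.1–2, image `inprint/lit-balaban-p14/renders-cmp155/p50_top_s2.png`)
PRINTS «If we restrict us to the region `0 ≤ ζ ≤ 1`, we have `(β/2)(1 + t²)[−3ζ/2 − 1/2 − κ(2 − (3/2)ζ)] ≤ −(β/4)(1 + κ)
≤ −(β/4)`. (VI.19)» (the scan's text layer, quoted by v1.1–v1.2 of this docstring, has «0 < ζ < 1» and garbles `(1 + κ)`;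
pointed out by the pub-balaban-gaps seat mrs-lit-2, 2026-08-22, whose `MagnenRivasseauSeneor1993.Stability.ineq_VI19_asPrinted`
is the printed chain). THIS theorem is the neighbouring true statement with a STRICT first inequality and the intermediate
`−(β/4)(1 + t²)`: for `0 < ζ < 1`, `κ ≥ 0` (p.372: `0 < κ < 1`), `β > 0` and every `t`,
`(β/2)(1 + t²)[−3ζ/2 − 1/2 − κ(2 − (3/2)ζ)] < −(β/4)(1 + t²) ≤ −(β/4)`; both it and the printed chain end in `≤ −β/4`, which
is what (VI.20b)/(VI.35) use. [cite: MagnenRivasseauSeneor1993, §VI (VI.19) p.374] -/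
theorem ineq_VI19 {ζ κ β : ℝ} (hζ0 : 0 < ζ) (hζ1 : ζ < 1) (hκ : 0 ≤ κ) (hβ : 0 < β) (t : ℝ) :
    β / 2 * (1 + t ^ 2) * (-3 * ζ / 2 - 1 / 2 - κ * (2 - 3 / 2 * ζ)) < -(β / 4) * (1 + t ^ 2) ∧
      -(β / 4) * (1 + t ^ 2) ≤ -(β / 4) := by
  have ht : (1 : ℝ) ≤ 1 + t ^ 2 := by nlinarith [sq_nonneg t]
  have hpos : 0 < β / 2 * (1 + t ^ 2) := by positivity
  constructor
  · have hbr : -3 * ζ / 2 - 1 / 2 - κ * (2 - 3 / 2 * ζ) < -(1 / 2) := by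
      have : 0 ≤ κ * (2 - 3 / 2 * ζ) := mul_nonneg hκ (by linarith)
      linarith
    have := mul_lt_mul_of_pos_left hbr hpos
    linarith
  · nlinarith

/-- (VI.19)'s conclusion from the assembled first order: for `0 < ζ < 1`, `κ ≥ 0`, `β > 0`,
`(β/2)(1+t²)·[FP + bosons + counterterms] < −β/4` (strict variant; the print has `≤` on `0 ≤ ζ ≤ 1`, see `ineq_VI19`).
[cite: MagnenRivasseauSeneor1993, §VI (VI.18)–(VI.19) pp.373–374] -/
theorem firstOrder_lt {ζ κ β : ℝ} (hζ0 : 0 < ζ) (hζ1 : ζ < 1) (hκ : 0 ≤ κ) (hβ : 0 < β) (t : ℝ) :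
    β / 2 * (1 + t ^ 2) * (fpFirstOrder κ + bosonFirstOrder ζ κ + countertermFirstOrder ζ κ) < -(β / 4) := by
  rw [firstOrder_assembly hζ0.ne' κ]
  have h := ineq_VI19 hζ0 hζ1 hκ hβ t
  exact lt_of_lt_of_le h.1 h.2

/-- At the homothetic gauge `ζ = 3/13` of §7 (inside the region `0 ≤ ζ ≤ 1` of (VI.19); p.374 tl.4–5 «we can restrict
us to a small interval centered respectively around 3/13 or 13/3») the (VI.18) bracket is `−11/13 − (43/26)κ`.
[cite: MagnenRivasseauSeneor1993, §VI (VI.18)–(VI.19) p.374] -/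
theorem firstOrder_at_homothetic (κ : ℝ) :
    fpFirstOrder κ + bosonFirstOrder (3 / 13) κ + countertermFirstOrder (3 / 13) κ = -(11 / 13) - 43 / 26 * κ := by
  rw [firstOrder_assembly (by norm_num) κ]
  ring

end OneLoop

end Literature.MathematicalPhysics.QuantumFieldTheory.MagnenRivasseauSeneor1993
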